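import Literature.Combinatorics.Optimization.SDPFormulationFactorization
import Literature.Barriers.PneNP.MatchingSlackPsdApproximation
import Literature.Barriers.PneNP.TSPExtensionComplexityMatchingsOps
import HarnessLib

/-!
# SDP formulations of `PM_n` factorize the odd-cut slack matrix

The perfect matching problem `PM_n` of Braun–Brown-Cohen–Huq–Pokutta–Raghavendra–Roy–Weitz–Zink
(feasible solutions: the perfect matchings `M` of `K_n`; objectives `f_F(M) = |M ∩ F|` for the edge sets
`F` of `K_n`; guarantees `S̃(f) = max f`, `C̃(f) = max f + ε/2`) is typed in the tree as
`Literature.Combinatorics.Optimization.pmProblem n ε` [cite: BraunEtAl2016, §4 (p. 7)], and a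
`(C̃, S̃)`-approximate SDP formulation of size `d` (Definition 2.2) as `SDPFormulation (pmProblem n ε) d`
[cite: BraunEtAl2016, Def. 2.2 (p. 5)].

In the proof of their main theorem the authors take the objective `f_{E[U]}` of the edges inside an odd
vertex set `U` and compute: "Since `|S|` is odd we have `max f_{E[S]} = (|S| − 1)/2`, from which we obtain
`C̃(f_{E[S]}) − f_{E[S]}(x) = (|S| − 1)/2 + ε/2 − Σ_{u,v ∈ S} x_{uv} = ½ Σ_{u ∈ S, v ∉ S} x_{uv} − (1 − ε)/2`"
[cite: BraunEtAl2016, §4.5, proof of Thm. 4.10 (p. 9)] — i.e. twice the slack of `f_{E[U]}` at `M` is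
`|δ(U) ∩ M| − 1 + ε`, the odd-cut slack entry `pmOddCutSlack n U M` (`= cc U M − 1`,
`Literature.Barriers.PneNP.pmOddCutSlack`) shifted by `ε`.

Combined with the factorization theorem for SDP formulations (`SDPFormulation.hasPsdFactorization_slack`,
[cite: BraunPokuttaZink2015, Thm. (SDP factorization)] [cite: BraunEtAl2016, Lemma 2.3 (p. 5)]) this file
PROVES (no named facts):

* `SDPFormulation.hasPsdFactorization_pmOddCutSlack_add` — an SDP formulation of size `d` of
  `pmProblem n ε` yields a psd factorization of size `d + 1` of `(U, M) ↦ pmOddCutSlack n U M + ε`;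
* `SDPFormulation.exists_posSemidef_slack_of_attained`, `SDPFormulation.hasPsdFactorization_slack_of_attained`
  — when `C̃(f)` is attained by a feasible solution (exact formulations) the constant `μ_f` vanishes and
  the factorization has size `d`, with column factors the `X^s` themselves;
* `SDPFormulation.hasPsdFactorization_pmOddCutSlack` (and `exists_hasPsdFactorization_pmOddCutSlack`, with
  the column factors `X^M` explicit) — the exact case `ε = 0`: a psd factorization of size `d` of the
  odd-cut slack matrix itself; and the contrapositives
  `SDPFormulation.isEmpty_of_not_hasPsdFactorization_pmOddCutSlack[_add]` — a lower bound `> d` on the psd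
  rank of the odd-cut slack matrix (resp. `> d + 1` for its `ε`-shift) rules out every (resp. every
  `ε`-approximate) SDP formulation of `PM_n` of size `d`, which is how psd-rank statements about
  `pmOddCutSlack` read as statements about SDP extended formulations of the matching problem
  (Yannakakis' theorem for SDPs, [cite: GouveiaParriloThomas2013, Thm. 2.4]
  [cite: BrietDadushPokutta2014, Thm. 4 (p. 5)]).

The combinatorial inputs (`|U| = |δ(U) ∩ M| + 2|M ∩ E[U]|` for a perfect matching `M`, and a perfect
matching with exactly `(|U| − 1)/2` edges inside the odd set `U`) are proved here from the tree's
matching toolkit (`IsPMOn.card_eq_sum_cutCount`, `IsPMOn.one_le_card_cut`, `exists_isPMOn_of_even`).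
No parity hypothesis on `n` is needed: for odd `n` there is no perfect matching and the factorization is
vacuous.
-/

noncomputable section

open Finset Matrix

namespace Literature.Combinatorics.Optimization

open Literature.Barriers.PneNP
open Literature.Combinatorics.SimpleGraph.CycleSpace (Crosses crosses_mk)
open Literature.Computation.Certificates.SemidefiniteComplementarity (frob_nonneg_of_posSemidef)

variable {n : ℕ}

/-! ### Counting edges of a perfect matching relative to a vertex set -/

/-- A pair crosses `U` iff it has exactly one endpoint in `U`. [folklore] -/
private theorem crosses_iff_cutCount_eq_one (U : Finset (Fin n)) (e : Sym2 (Fin n)) :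
    Crosses U e ↔ cutCount U e = 1 := by
  induction e using Sym2.ind with
  | h a b =>
    rw [crosses_mk, cutCount_mk]
    by_cases ha : a ∈ U <;> by_cases hb : b ∈ U <;> simp [ha, hb]

/-- A pair lies inside `U` iff it has two endpoints in `U`. [folklore] -/
private theorem mem_sym2_iff_cutCount_eq_two (U : Finset (Fin n)) (e : Sym2 (Fin n)) :
    e ∈ U.sym2 ↔ cutCount U e = 2 := by
  induction e using Sym2.ind with
  | h a b =>
    rw [Finset.mk_mem_sym2_iff, cutCount_mk]
    by_cases ha : a ∈ U <;> by_cases hb : b ∈ U <;> simp [ha, hb]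

/-- `cc U M = |δ(U) ∩ M|` counted with `cutCount` (bridges the `Crosses`-form of the Rothvoß files and
the `cutCount`-form of `pmSlack` / `TSPExtensionComplexityPMPolytope`). [cite: Rothvoss2017, §2 (PDF p. 5)] -/
theorem cc_eq_card_filter (U : OddSet n) (M : PMatch n) :
    cc U M = (M.1.filter fun e => cutCount U.1 e = 1).card := by
  unfold cc
  rw [Finset.filter_congr fun e (_ : e ∈ M.1) => crosses_iff_cutCount_eq_one U.1 e]

/-- **`|U| = |δ(U) ∩ M| + 2 |M ∩ E[U]|`** for a perfect matching `M` of `K_n`. [folklore] -/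
private theorem card_eq_cc_add_two_mul (U : OddSet n) (M : PMatch n) :
    U.1.card = cc U M + 2 * (M.1 ∩ U.1.sym2).card := by
  rw [M.2.card_eq_sum_cutCount (subset_univ U.1), sum_cutCount_eq, cc_eq_card_filter,
    Finset.filter_congr fun e (_ : e ∈ M.1) => (mem_sym2_iff_cutCount_eq_two U.1 e).symm,
    Finset.filter_mem_eq_inter]

/-- Hence `2 |M ∩ E[U]| + 1 ≤ |U|` for odd `U` (an odd cut is crossed). [folklore] -/
private theorem two_mul_inner_add_one_le (U : OddSet n) (M : PMatch n) :
    2 * (M.1 ∩ U.1.sym2).card + 1 ≤ U.1.card := by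
  have h1 := card_eq_cc_add_two_mul U M
  have h2 : 1 ≤ cc U M := by
    rw [cc_eq_card_filter]
    exact M.2.one_le_card_cut (subset_univ U.1) U.2
  omega

/-- A perfect matching of `S` has `|S|/2` edges. [folklore] -/
private theorem card_eq_two_mul_of_isPMOn {S : Finset (Fin n)} {M : Finset (Sym2 (Fin n))}
    (h : IsPMOn S M) : S.card = 2 * M.card := by
  rw [h.card_eq_sum_cutCount subset_rfl, Finset.card_eq_sum_ones M, Finset.mul_sum]
  refine Finset.sum_congr rfl fun e he => ?_
  rw [mul_one]
  exact (mem_sym2_iff_cutCount_eq_two S e).1 (h.subset_sym2 he)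

/-- For an odd vertex set `U` of `K_n` (with `K_n` having a perfect matching at all) there is a perfect
matching with exactly `(|U| − 1)/2` edges inside `U` ("since `|S|` is odd we have
`max f_{E[S]} = (|S| − 1)/2`"). [cite: BraunEtAl2016, §4.5, proof of Thm. 4.10 (p. 9)] -/
private theorem exists_pm_two_mul_inner_add_one_eq (U : OddSet n) (M : PMatch n) :
    ∃ M₀ : PMatch n, 2 * (M₀.1 ∩ U.1.sym2).card + 1 = U.1.card := by
  classical
  obtain ⟨U, hU⟩ := U
  have hn : (univ : Finset (Fin n)).card = 2 * M.1.card := card_eq_two_mul_of_isPMOn M.2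
  obtain ⟨u, hu⟩ : U.Nonempty := card_pos.1 hU.pos
  have hUc : Odd Uᶜ.card := by
    have hle : U.card ≤ (univ : Finset (Fin n)).card := card_le_card (subset_univ U)
    rw [Finset.card_compl, ← Finset.card_univ, hn] at *
    rcases hU with ⟨k, hk⟩
    exact ⟨M.1.card - k - 1, by omega⟩
  obtain ⟨v, hv⟩ : Uᶜ.Nonempty := card_pos.1 hUc.pos
  have hvU : v ∉ U := Finset.mem_compl.1 hv
  have huv : u ≠ v := fun h => hvU (h ▸ hu)
  have h1 : Even (U.erase u).card := by
    rw [card_erase_of_mem hu]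
    exact Nat.Odd.sub_odd hU odd_one
  have h2 : Even (Uᶜ.erase v).card := by
    rw [card_erase_of_mem hv]
    exact Nat.Odd.sub_odd hUc odd_one
  obtain ⟨M₁, hM₁⟩ := exists_isPMOn_of_even _ (U.erase u) rfl h1
  obtain ⟨M₂, hM₂⟩ := exists_isPMOn_of_even _ (Uᶜ.erase v) rfl h2
  have hd1 : Disjoint ({u, v} : Finset (Fin n)) (U.erase u) := by
    rw [Finset.disjoint_insert_left, Finset.disjoint_singleton_left]
    exact ⟨notMem_erase u U, fun h => hvU (mem_of_mem_erase h)⟩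
  have hd2 : Disjoint (({u, v} : Finset (Fin n)) ∪ U.erase u) (Uᶜ.erase v) := by
    rw [Finset.disjoint_left]
    intro x hx hx'
    have hxv : x ≠ v := ne_of_mem_erase hx'
    have hxU : x ∉ U := Finset.mem_compl.1 (mem_of_mem_erase hx')
    rcases Finset.mem_union.1 hx with hx | hx
    · rcases Finset.mem_insert.1 hx with rfl | hx
      · exact hxU hu
      · exact hxv (Finset.mem_singleton.1 hx)
    · exact hxU (mem_of_mem_erase hx)
  have h012 := ((IsPMOn.pair huv).union hM₁ hd1).union hM₂ hd2
  have hS : (({u, v} : Finset (Fin n)) ∪ U.erase u) ∪ Uᶜ.erase v = univ := by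
    ext x
    simp only [mem_union, mem_insert, mem_singleton, mem_erase, mem_compl, mem_univ, iff_true]
    by_cases hxU : x ∈ U
    · by_cases hxu : x = u
      · exact Or.inl (Or.inl (Or.inl hxu))
      · exact Or.inl (Or.inr ⟨hxu, hxU⟩)
    · by_cases hxv : x = v
      · exact Or.inl (Or.inl (Or.inr hxv))
      · exact Or.inr ⟨hxv, hxU⟩
  rw [hS] at h012
  refine ⟨⟨_, h012⟩, ?_⟩
  -- `M₁ ⊆ M₀ ∩ E[U]`, `|U| − 1 = 2 |M₁|`, and the upper bound `2 |M₀ ∩ E[U]| + 1 ≤ |U|`.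
  have hsub : M₁ ⊆ (({s(u, v)} ∪ M₁) ∪ M₂) ∩ U.sym2 := by
    intro e he
    refine Finset.mem_inter.2 ⟨mem_union_left _ (mem_union_right _ he), ?_⟩
    exact Finset.sym2_mono (erase_subset u U) (hM₁.subset_sym2 he)
  have hle := card_le_card hsub
  have hc1 : (U.erase u).card = 2 * M₁.card := card_eq_two_mul_of_isPMOn hM₁
  rw [card_erase_of_mem hu] at hc1
  have hup := two_mul_inner_add_one_le ⟨U, hU⟩ ⟨_, h012⟩
  have hpos := hU.pos
  simp only at hup ⊢
  omega

/-- Edges of a perfect matching inside `U`: intersecting with the non-loop pairs of `E[U]` is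
intersecting with `U.sym2` (a perfect matching has no loops). [folklore] -/
private theorem inter_filter_not_isDiag (M : PMatch n) (U : Finset (Fin n)) :
    M.1 ∩ U.sym2.filter (fun e => ¬e.IsDiag) = M.1 ∩ U.sym2 := by
  ext e
  simp only [mem_inter, mem_filter]
  exact ⟨fun h => ⟨h.1, h.2.1⟩, fun h => ⟨h.1, h.2, M.2.not_isDiag h.1⟩⟩

/-- **`max f_{E[U]} = (|U| − 1)/2`** for an odd vertex set `U` (given that `K_n` has a perfect matching).
[cite: BraunEtAl2016, §4.5, proof of Thm. 4.10 (p. 9)] -/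
theorem pmMax_inner_eq (U : OddSet n) (M : PMatch n) (F : EdgeSet n)
    (hF : F.edges = U.1.sym2.filter fun e => ¬e.IsDiag) :
    pmMax F = ((U.1.card : ℝ) - 1) / 2 := by
  have hval : ∀ M' : PMatch n, pmVal F M' = (((M'.1 ∩ U.1.sym2).card : ℕ) : ℝ) := by
    intro M'
    unfold pmVal
    rw [hF, inter_filter_not_isDiag]
  obtain ⟨M₀, hM₀⟩ := exists_pm_two_mul_inner_add_one_eq U M
  refine le_antisymm (csSup_le ⟨_, M₀, rfl⟩ ?_) (le_csSup (Set.finite_range _).bddAbove ⟨M₀, ?_⟩)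
  · rintro _ ⟨M', rfl⟩
    rw [hval]
    have h := two_mul_inner_add_one_le U M'
    have h' : (2 : ℝ) * (((M'.1 ∩ U.1.sym2).card : ℕ) : ℝ) + 1 ≤ (U.1.card : ℝ) := by
      exact_mod_cast h
    linarith
  · rw [hval]
    have h' : (2 : ℝ) * (((M₀.1 ∩ U.1.sym2).card : ℕ) : ℝ) + 1 = (U.1.card : ℝ) := by
      exact_mod_cast hM₀
    linarith

/-- **Twice the slack of `f_{E[U]}` is the odd-cut slack, shifted by `ε`**:
`2 (C̃(f_{E[U]}) − f_{E[U]}(M)) = |δ(U) ∩ M| − 1 + ε`.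
[cite: BraunEtAl2016, §4.5, proof of Thm. 4.10 (p. 9)] -/
theorem two_mul_pmSlack_inner_eq (ε : ℝ) (U : OddSet n) (M : PMatch n) (F : EdgeSet n)
    (hF : F.edges = U.1.sym2.filter fun e => ¬e.IsDiag) :
    2 * ((pmProblem n ε).C F - (pmProblem n ε).val F M) = pmOddCutSlack n U M + ε := by
  rw [pmProblem_C, pmProblem_val, pmMax_inner_eq U M F hF, hF, inter_filter_not_isDiag M U.1,
    pmOddCutSlack_apply]
  have h := card_eq_cc_add_two_mul U M
  have h' : (U.1.card : ℝ) = (cc U M : ℝ) + 2 * (((M.1 ∩ U.1.sym2).card : ℕ) : ℝ) := by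
    exact_mod_cast h
  linarith

/-! ### Exact objectives: the constant `μ_f` vanishes -/

/-- For a sound objective `f` whose guarantee `C̃(f)` is ATTAINED by a feasible solution (as for an exact
formulation, `C̃(f) = max f` over a finite solution set) the constant of the factorization theorem
vanishes: `C̃(f) − f(s) = tr(U^f X^s)` for all `s` (evaluate at the maximiser: `0 = tr(U^f X^{s₀}) + μ_f`
with both terms nonnegative). [cite: BraunEtAl2016, Lemma 2.3 (p. 5)]
[cite: GouveiaParriloThomas2013, Thm. 2.4] -/
theorem SDPFormulation.exists_posSemidef_slack_of_attained {σ φ : Type*} {P : MaxProblem σ φ} {d : ℕ}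
    (E : SDPFormulation P d) {f : φ} (hf : P.Sound f) (hatt : ∃ s₀, P.val f s₀ = P.C f) :
    ∃ U : Matrix (Fin d) (Fin d) ℝ, U.PosSemidef ∧ ∀ s, P.C f - P.val f s = (U * E.X s).trace := by
  obtain ⟨U, hU, μ, hμ, h⟩ := E.exists_posSemidef_slack hf
  obtain ⟨s₀, hs₀⟩ := hatt
  have h0 := h s₀
  rw [hs₀, sub_self] at h0
  have htr : 0 ≤ (U * E.X s₀).trace := frob_nonneg_of_posSemidef hU (E.posSemidef_X s₀)
  have hμ0 : μ = 0 := le_antisymm (by linarith) hμ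
  refine ⟨U, hU, fun s => ?_⟩
  rw [h s, hμ0, add_zero]

/-- **Yannakakis' factorization theorem for SDPs, exact case, direction formulation ⇒ factorization**:
an SDP formulation of size `d` gives a psd factorization of size `d` (no extra coordinate) of the slack
matrix `(f, s) ↦ C̃(f) − f(s)` over the sound objectives whose guarantee is attained, with column
factors the formulation's own `X^s`. [cite: GouveiaParriloThomas2013, Thm. 2.4]
[cite: BrietDadushPokutta2014, Thm. 4 (p. 5)] [cite: BraunEtAl2016, Lemma 2.3 (p. 5)] -/
theorem SDPFormulation.hasPsdFactorization_slack_of_attained {σ φ : Type*} {P : MaxProblem σ φ} {d : ℕ}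
    (E : SDPFormulation P d) :
    HasPsdFactorization
      (fun (f : {f : φ // P.Sound f ∧ ∃ s₀, P.val f s₀ = P.C f}) (s : σ) => P.C f.1 - P.val f.1 s) d := by
  classical
  choose U hU hslack using fun f : {f : φ // P.Sound f ∧ ∃ s₀, P.val f s₀ = P.C f} =>
    E.exists_posSemidef_slack_of_attained f.2.1 f.2.2
  exact ⟨U, E.X, hU, E.posSemidef_X, fun f s => hslack f s⟩

/-- In `PM_n` with `ε = 0` every guarantee `C̃(f_F) = max f_F` is attained (a finite, nonempty set of
values, once `K_n` has a perfect matching). [cite: BraunEtAl2016, §4 (p. 7)] -/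
theorem pmProblem_attained [Nonempty (PMSol n)] (F : EdgeSet n) :
    ∃ M : PMSol n, (pmProblem n 0).val F M = (pmProblem n 0).C F := by
  obtain ⟨M, hM⟩ := (Set.range_nonempty (pmVal F)).csSup_mem (Set.finite_range _)
  refine ⟨M, ?_⟩
  rw [pmProblem_C, zero_div, add_zero]
  exact hM

/-! ### SDP formulations of `PM_n` give psd factorizations of the odd-cut slack matrix -/

/-- **An `ε`-approximate SDP formulation of `PM_n` of size `d` yields a psd factorization of size
`d + 1` of the shifted odd-cut slack matrix `(U, M) ↦ |δ(U) ∩ M| − 1 + ε`** (the factorization theorem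
for SDP formulations applied to the objectives `f_{E[U]}`, `U` odd, whose slack is half the shifted
odd-cut slack; the row factors are doubled). [cite: BraunEtAl2016, Lemma 2.3 (p. 5) and §4.5 (p. 9)]
[cite: BraunPokuttaZink2015, Thm. (SDP factorization)] -/
theorem SDPFormulation.hasPsdFactorization_pmOddCutSlack_add {d : ℕ} {ε : ℝ}
    (E : SDPFormulation (pmProblem n ε) d) :
    HasPsdFactorization (fun (U : OddSet n) (M : PMatch n) => pmOddCutSlack n U M + ε) (d + 1) := by
  classical
  rcases isEmpty_or_nonempty (PMatch n) with hE | ⟨⟨M₀⟩⟩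
  · exact ⟨fun _ => 0, fun M => hE.elim M, fun _ => PosSemidef.zero, fun M => hE.elim M,
      fun _ M => hE.elim M⟩
  obtain ⟨A, B, hA, hB, hAB⟩ := E.hasPsdFactorization_slack
  let F : OddSet n → EdgeSet n := fun U =>
    ⟨U.1.sym2.filter fun e => ¬e.IsDiag, fun e he => (mem_filter.1 he).2⟩
  refine ⟨fun U => (2 : ℝ) • A ⟨F U, pmProblem_sound ε (F U)⟩, B, fun U => (hA _).smul zero_le_two,
    hB, fun U M => ?_⟩
  show pmOddCutSlack n U M + ε = ((2 : ℝ) • A ⟨F U, pmProblem_sound ε (F U)⟩ * B M).trace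
  rw [Matrix.smul_mul, trace_smul, smul_eq_mul, ← hAB ⟨F U, pmProblem_sound ε (F U)⟩ M]
  exact (two_mul_pmSlack_inner_eq ε U M (F U) rfl).symm

/-- **An (exact, `ε = 0`) SDP formulation of `PM_n` of size `d` yields a psd factorization of size `d`
of the odd-cut slack matrix `S_{UM} = |δ(U) ∩ M| − 1`**, with column factors the formulation's `X^M` and
row factors `2 U^{f_{E[U]}}` (the constants `μ_f` vanish because `max f_{E[U]}` is attained).
[cite: BraunEtAl2016, Lemma 2.3 (p. 5) and §4.5 (p. 9)] [cite: GouveiaParriloThomas2013, Thm. 2.4]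
[cite: BrietDadushPokutta2014, Thm. 4 (p. 5)] -/
theorem SDPFormulation.exists_hasPsdFactorization_pmOddCutSlack {d : ℕ}
    (E : SDPFormulation (pmProblem n 0) d) :
    ∃ A : OddSet n → Matrix (Fin d) (Fin d) ℝ, (∀ U, (A U).PosSemidef) ∧
      ∀ (U : OddSet n) (M : PMatch n), pmOddCutSlack n U M = (A U * E.X M).trace := by
  classical
  rcases isEmpty_or_nonempty (PMatch n) with hE | hne
  · exact ⟨fun _ => 0, fun _ => PosSemidef.zero, fun _ M => hE.elim M⟩
  choose Uf hU hslack using fun F : EdgeSet n =>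
    E.exists_posSemidef_slack_of_attained (pmProblem_sound 0 F) (pmProblem_attained F)
  let F : OddSet n → EdgeSet n := fun U =>
    ⟨U.1.sym2.filter fun e => ¬e.IsDiag, fun e he => (mem_filter.1 he).2⟩
  refine ⟨fun U => (2 : ℝ) • Uf (F U), fun U => (hU _).smul zero_le_two, fun U M => ?_⟩
  show pmOddCutSlack n U M = ((2 : ℝ) • Uf (F U) * E.X M).trace
  rw [Matrix.smul_mul, trace_smul, smul_eq_mul, ← hslack (F U) M, ← add_zero (pmOddCutSlack n U M)]
  exact (two_mul_pmSlack_inner_eq 0 U M (F U) rfl).symm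

/-- Hence: **an (exact) SDP formulation of `PM_n` of size `d` gives `rk_psd(S) ≤ d`** for the odd-cut slack
matrix `S` — Yannakakis' factorization theorem for SDPs, direction used for lower bounds.
[cite: GouveiaParriloThomas2013, Thm. 2.4] [cite: BrietDadushPokutta2014, Thm. 4 (p. 5)]
[cite: BraunEtAl2016, Lemma 2.3 (p. 5) and §4.5 (p. 9)] -/
theorem SDPFormulation.hasPsdFactorization_pmOddCutSlack {d : ℕ} (E : SDPFormulation (pmProblem n 0) d) :
    HasPsdFactorization (pmOddCutSlack n) d := by
  obtain ⟨A, hA, h⟩ := E.exists_hasPsdFactorization_pmOddCutSlack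
  exact ⟨A, fun M => E.X M, hA, fun M => E.posSemidef_X M, h⟩

/-- Contrapositive, approximate form: **if the `ε`-shifted odd-cut slack matrix has no psd factorization
of size `d + 1`, then `PM_n` has no `ε`-approximate SDP formulation of size `d`.**
[cite: BraunEtAl2016, Lemma 2.3 (p. 5) and §4.5 (p. 9)] -/
theorem SDPFormulation.isEmpty_of_not_hasPsdFactorization_pmOddCutSlack_add {d : ℕ} {ε : ℝ}
    (h : ¬HasPsdFactorization (fun (U : OddSet n) (M : PMatch n) => pmOddCutSlack n U M + ε) (d + 1)) :
    IsEmpty (SDPFormulation (pmProblem n ε) d) :=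
  ⟨fun E => h E.hasPsdFactorization_pmOddCutSlack_add⟩

/-- Contrapositive, exact form: **a lower bound `> d` on the psd rank of the odd-cut slack matrix of
the perfect matching polytope rules out every SDP formulation (Definition 2.2, `ε = 0`) of `PM_n` of
size `d`** — Yannakakis' factorization theorem for SDPs, direction used for lower bounds.
[cite: BraunEtAl2016, Lemma 2.3 (p. 5)] [cite: GouveiaParriloThomas2013, Thm. 2.4]
[cite: BrietDadushPokutta2014, Thm. 4 (p. 5)] -/
theorem SDPFormulation.isEmpty_of_not_hasPsdFactorization_pmOddCutSlack {d : ℕ}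
    (h : ¬HasPsdFactorization (pmOddCutSlack n) d) :
    IsEmpty (SDPFormulation (pmProblem n 0) d) :=
  ⟨fun E => h E.hasPsdFactorization_pmOddCutSlack⟩

end Literature.Combinatorics.Optimization
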